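import Summits.ResolutionOfSingularities.ResolutionOfSingularities.Theorems.RadicialJungCleanModelsNSRankOneReduction
import Summits.ResolutionOfSingularities.ResolutionOfSingularities.Theorems.RadicialJungCleanModelsNSResidueChainsOfCJS
import Summits.ResolutionOfSingularities.ResolutionOfSingularities.Theorems.RadicialJungCleanModelsStubCjs2020Cor15
import Literature.AlgebraicGeometry.Resolution.AffineDomainDimension
import HarnessLib

/-!
# `hMono_4` at every zero-dimensional valuation from `hMono_4` at RANK ONE, modulo F-02 and F-32 ONLY (the residue-side chains discharged)

Route `RadicialJung`, crux `CleanModels` (stmt-ResolutionOfSingularities-15917), registered skeleton `Cruxes/CleanModels/Lines/Sketch.lean`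
rev 35 (sha16 de44649d8f729c3b), stub 7 `stub_cleanModelsDimGEFour`.  Explicit-unit seat `decomp-res-hand-2` g6 (structural hand).  OURS; structural
bookkeeping, counted 0; nothing here proves resolution of singularities in characteristic `p`.

`localMonomialization_four_of_rankOne_of_cjs2020` — ✓ `localMonomialization_four_of_rankOne_of_residueChains` (hand-2 g5, the repaired
Novacoski–Spivakovsky 2012 Thm. 1.2 in transcendence degree `4`) with its residue-side hypothesis `hChains` DISCHARGED by
✓ `residueChains_of_cjs2020` (this seat) and its `hEmb` (CJS Cor. 1.5 shape) by ✓ `stub_cjs2020Cor15_of_embedded`: local uniformization WITH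
MONOMIALIZATION (`hMono_4`, regular start) holds at EVERY zero-dimensional valuation ring of a function field of transcendence degree `≤ 4` as soon
as it holds at the RANK-ONE ones, given the two PRINTED facts F-02 (`CossartPiltant2019`, CP 2019 Thm. 1.1) and F-32
(`CossartJannsenSaito2020Embedded`, CJS 2020 Thm. 1.4 with `B = ∅`) — both registered stubs of the skeleton (`stub_cossartPiltant2019`,
`stub_cjs2020Thm14`).  After this the local input `hMonoRes_4` of stub 7 is needed at RANK-ONE zero-dimensional (non-Abhyankar) valuations only.
[cite: NovacoskiSpivakovsky2014, Thm. 1.2 and §3.2] [cite: CossartPiltant2019, Thm. 1.1] [cite: CossartJannsenSaito2020, Thm. 1.4 and Cor. 1.5]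
-/

noncomputable section

set_option linter.dupNamespace false -- mandated namespace of this single-conjunct summit

open IsLocalRing AlgebraicGeometry CategoryTheory
open Literature.AlgebraicGeometry.Resolution Literature.AlgebraicGeometry.Motives

namespace Summit.ResolutionOfSingularities.ResolutionOfSingularities.Theorems.RadicialJung.CleanModels

/-- **`hMono_4` everywhere from `hMono_4` at rank one, modulo F-02 + F-32 only.**  See the module docstring.
[cite: NovacoskiSpivakovsky2014, Thm. 1.2 and §3.2] [cite: CossartPiltant2019, Thm. 1.1] [cite: CossartJannsenSaito2020, Thm. 1.4 and Cor. 1.5] -/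
theorem localMonomialization_four_of_rankOne_of_cjs2020 (hCP : CossartPiltant2019.{0}) (hCJS : CossartJannsenSaito2020Embedded.{0})
    {k K : Type} [Field k] [Field K] [Algebra k K]
    (O : ValuationSubring K)
    (hRankOne : ¬ (∃ O₁ : ValuationSubring K, O ≤ O₁ ∧ O₁ ≠ O ∧ O₁ ≠ ⊤) →
      ∀ (A : Subalgebra k K), A.toSubring ≤ O.toSubring → A.FG → IsFractionRing A K →
      ringKrullDim A ≤ (4 : WithBot ℕ∞) →
      ∀ Z : Finset K, (∀ z ∈ Z, z ∈ A) →
      ∃ (A' : Subalgebra k K), A'.toSubring ≤ O.toSubring ∧ A ≤ A' ∧ A'.FG ∧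
      ∃ (_ : IsRegularLocalRing (locAtCentre A'.toSubring O)) (e : ℕ) (a : Fin e → ↥(locAtCentre A'.toSubring O)),
        Ideal.span (Set.range a) = IsLocalRing.maximalIdeal ↥(locAtCentre A'.toSubring O) ∧
        ringKrullDim ↥(locAtCentre A'.toSubring O) = (e : WithBot ℕ∞) ∧
        ∀ z ∈ Z, z ≠ 0 → ∃ (v : ↥(locAtCentre A'.toSubring O)) (μ : Fin e → ℕ), IsUnit v ∧
          z = (v : K) * ∏ i, ((a i : ↥(locAtCentre A'.toSubring O)) : K) ^ (μ i))
    (A : Subalgebra k K) (hAO : A.toSubring ≤ O.toSubring) (hAfg : A.FG) (hfrac : IsFractionRing A K)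
    (hdimA : ringKrullDim A ≤ (4 : WithBot ℕ∞)) (Z : Finset K) (hZ : ∀ z ∈ Z, z ∈ A) :
    ∃ (A' : Subalgebra k K), A'.toSubring ≤ O.toSubring ∧ A ≤ A' ∧ A'.FG ∧
      ∃ (_ : IsRegularLocalRing (locAtCentre A'.toSubring O)) (e : ℕ) (a : Fin e → ↥(locAtCentre A'.toSubring O)),
        Ideal.span (Set.range a) = IsLocalRing.maximalIdeal ↥(locAtCentre A'.toSubring O) ∧
        ringKrullDim ↥(locAtCentre A'.toSubring O) = (e : WithBot ℕ∞) ∧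
        ∀ z ∈ Z, z ≠ 0 → ∃ (v : ↥(locAtCentre A'.toSubring O)) (μ : Fin e → ℕ), IsUnit v ∧
          z = (v : K) * ∏ i, ((a i : ↥(locAtCentre A'.toSubring O)) : K) ^ (μ i) := by
  classical
  haveI := hfrac
  haveI : Algebra.FiniteType k A := (Subalgebra.fg_iff_finiteType A).mp hAfg
  -- `trdeg_k K = dim A ≤ 4`, so every finitely generated model of `K/k` has dimension `≤ 4`
  obtain ⟨nA, hnA, htrA⟩ := exists_ringKrullDim_eq_and_trdeg_eq k A
  have hK4 : Algebra.trdeg k K ≤ 4 := by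
    rw [trdeg_eq_trdeg_of_isFractionRing A, htrA]
    rw [hnA] at hdimA
    exact_mod_cast (show nA ≤ 4 by exact_mod_cast hdimA)
  refine localMonomialization_four_of_rankOne_of_residueChains hCP (stub_cjs2020Cor15_of_embedded hCJS) O
    (fun O₁ hO _ hO₁ A' hA' hA'fg hfrac' hreg' W hW => ?_) hRankOne A hAO hAfg hfrac hdimA Z hZ
  haveI := hfrac'
  have hdimA' : ringKrullDim A' ≤ 4 := by exact_mod_cast ringKrullDim_le_of_fg_of_trdeg_le A' hA'fg hK4
  exact residueChains_of_cjs2020 hCJS O O₁ hO hO₁ A' hA' hA'fg hfrac' hdimA' hreg' W hW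

end Summit.ResolutionOfSingularities.ResolutionOfSingularities.Theorems.RadicialJung.CleanModels

end
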